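import Summits.HodgeConjecture.CorCM.GenericCMFieldTypes
import Summits.HodgeConjecture.CorCM.QuadraticSubfieldFibres
import HarnessLib

/-!
# Pair-flip CM fields: the obstruction by an imaginary quadratic subfield, and `B• = D•` on all products of pairwise
# non-isogenous varieties with CM by the field ⟺ independent type vectors

COR-CM (cell `pub-hodgecm2`), seat p2 gen 21; count-neutral; theorems only, no definition, no named fact, no `sorry`.
Complements `CorCM/GenericCMFieldTypes` (pair-flip hypothesis: every conjugate pair `{s, s̄} ⊆ Hom(K, ℂ)` is flipped by
an automorphism of `ℂ` fixing all other embeddings; then every CM type of `K` is nondegenerate and a family of types is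
nondegenerate iff its type vectors are linearly independent).

* §1 **`not_pairFlip_of_quadratic`** — a CM field of degree `≥ 4` containing an imaginary quadratic field `k` admits NO
  pair flips: a flip of `{s, s̄}` acts on `k` both as conjugation (through `s`) and trivially (through another embedding
  `t ∉ {s, s̄}` with `t|_k = s|_k`, which exists because each fibre of `Hom(K,ℂ) → Hom(k,ℂ)` has `[K:ℚ]/2 ≥ 2` elements).
  Equivalently (`isEmpty_ringHom_of_pairFlip`) a pair-flip field of degree `≥ 4` has no imaginary quadratic subfield —
  for sextic fields this is also sufficient (Galois closure of degree `24` or `48`), not proved here.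
* §2 **`forall_prod_hodgeClassSpan_eq_iff_linearIndependent`** — for pairwise non-isogenous abelian varieties `A_i` with
  CM by one pair-flip field `K` (types `Φ_i`): `Bᵐ = Dᵐ` on EVERY product `⨁_{j<N} A_{π j}` ⟺ the type vectors `u_{Φ_i}`
  are linearly independent; **`exists_exceptional_prod_iff_not_linearIndependent`** — an exceptional Hodge class on
  SOME product ⟺ they are dependent (Theorem 7.5 of Gordon's survey, (1) ⟺ (3), with (3) read off the type vectors).
-/

noncomputable section

open CategoryTheory CategoryTheory.Limits NumberField NumberField.ComplexEmbedding

namespace Summit.HodgeConjecture.CorCM.GenericCMField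

open Literature.NumberTheory.ComplexMultiplication
open Literature.AlgebraicGeometry.Motives (AbelianVariety CMType)
open Literature.AlgebraicGeometry.HodgeTheory
open Literature.AlgebraicGeometry.ComplexMultiplication (IsCMTypeRealisation)
open Literature.AlgebraicGeometry.VanGeemen1994 (hodgeClassSpan)
open Literature.AlgebraicGeometry.Pohlmann1968
open Literature.Barriers.HodgeConjecture (divisorClassesSpan)

/-! ## §1 An imaginary quadratic subfield obstructs pair flips -/

section Quadratic

variable {k K : Type} [Field k] [NumberField k] [Field K] [NumberField K]

open scoped Classical in
/-- **Each fibre of `Hom(K, ℂ) → Hom(k, ℂ)` over an imaginary quadratic `k ↪ K` has `[K:ℚ]/2` elements**: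
`2 · #{s | s ∘ e = ψ} = [K : ℚ]` (the fibres over `ψ`, `ψ̄` partition `Hom(K, ℂ)` and are exchanged by conjugation). -/
theorem two_mul_card_fibre_eq (Ψ : CMType k) (h2 : Module.finrank ℚ k = 2) (e : k →+* K) (ψ : k →+* ℂ) :
    2 * (Finset.univ.filter fun s : K →+* ℂ => s.comp e = ψ).card = Module.finrank ℚ K := by
  have hunion : (Finset.univ.filter fun s : K →+* ℂ => s.comp e = ψ) ∪
      (Finset.univ.filter fun s : K →+* ℂ => s.comp e = conjugate ψ) = Finset.univ := by
    ext s
    simp only [Finset.mem_union, Finset.mem_filter, Finset.mem_univ, true_and, iff_true]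
    exact WeilFibre.comp_eq_or_eq_conjugate Ψ h2 e ψ s
  have hdisj : Disjoint (Finset.univ.filter fun s : K →+* ℂ => s.comp e = ψ)
      (Finset.univ.filter fun s : K →+* ℂ => s.comp e = conjugate ψ) := by
    rw [Finset.disjoint_filter]
    intro s _ h1 h2'
    exact conjugate_ne_self Ψ ψ (h2'.symm.trans h1)
  have hsum := Finset.card_union_of_disjoint hdisj
  rw [hunion, Finset.card_univ, Embeddings.card, ← WeilFibre.card_fibre_eq_card_fibre_conjugate e ψ] at hsum
  omega

/-- **A CM field of degree `≥ 4` with an imaginary quadratic subfield `k` (a CM type `Ψ` of `k` witnessing that `k` is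
totally imaginary) admits no pair flips.** -/
theorem not_pairFlip_of_quadratic (Ψ : CMType k) (h2 : Module.finrank ℚ k = 2) (e : k →+* K)
    (h4 : 4 ≤ Module.finrank ℚ K) :
    ¬ ∀ s : K →+* ℂ, ∃ σ : ℂ ≃+* ℂ, σ • s = (starRingAut : ℂ ≃+* ℂ) • s ∧
      ∀ t : K →+* ℂ, t ≠ s → t ≠ (starRingAut : ℂ ≃+* ℂ) • s → σ • t = t := by
  classical
  intro hflip
  obtain ⟨s₀⟩ : Nonempty (K →+* ℂ) := inferInstance
  set ψ : k →+* ℂ := s₀.comp e with hψ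
  -- another embedding `t ∉ {s₀, s̄₀}` in the fibre of `ψ`
  have hcard : 2 ≤ (Finset.univ.filter fun s : K →+* ℂ => s.comp e = ψ).card := by
    have := two_mul_card_fibre_eq (K := K) Ψ h2 e ψ
    omega
  obtain ⟨t, ht, hts⟩ : ∃ t ∈ (Finset.univ.filter fun s : K →+* ℂ => s.comp e = ψ), t ≠ s₀ :=
    Finset.exists_mem_ne hcard s₀
  simp only [Finset.mem_filter, Finset.mem_univ, true_and] at ht
  have htc : t ≠ (starRingAut : ℂ ≃+* ℂ) • s₀ := fun h => by
    have h1 : t.comp e = conjugate ψ := by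
      rw [h, conj_smul_eq_conjugate, WeilFibre.conjugate_comp]
    exact conjugate_ne_self Ψ ψ (h1.symm.trans ht)
  obtain ⟨σ, hσs, hσt⟩ := hflip s₀
  have hfix := hσt t hts htc
  -- `σ` acts on `ψ` trivially (through `t`) and as conjugation (through `s₀`)
  have h1 : (σ : ℂ →+* ℂ).comp ψ = ψ := by
    rw [← ht, ← RingHom.comp_assoc]
    exact congrArg (fun u : K →+* ℂ => u.comp e) (show σ • t = t from hfix)
  have h2' : (σ : ℂ →+* ℂ).comp ψ = conjugate ψ := by
    rw [hψ, ← RingHom.comp_assoc, ← WeilFibre.conjugate_comp, ← conj_smul_eq_conjugate]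
    exact congrArg (fun u : K →+* ℂ => u.comp e) (show σ • s₀ = (starRingAut : ℂ ≃+* ℂ) • s₀ from hσs)
  exact conjugate_ne_self Ψ ψ (h2'.symm.trans h1)

/-- **A pair-flip CM field of degree `≥ 4` has no imaginary quadratic subfield** (no embedding `k ↪ K` of a
quadratic field carrying a CM type). -/
theorem isEmpty_ringHom_of_pairFlip (Ψ : CMType k) (h2 : Module.finrank ℚ k = 2) (h4 : 4 ≤ Module.finrank ℚ K)
    (hflip : ∀ s : K →+* ℂ, ∃ σ : ℂ ≃+* ℂ, σ • s = (starRingAut : ℂ ≃+* ℂ) • s ∧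
      ∀ t : K →+* ℂ, t ≠ s → t ≠ (starRingAut : ℂ ≃+* ℂ) • s → σ • t = t) :
    IsEmpty (k →+* K) :=
  ⟨fun e => not_pairFlip_of_quadratic Ψ h2 e h4 hflip⟩

end Quadratic

/-! ## §2 `B• = D•` on all products ⟺ independent type vectors; exceptional classes ⟺ dependent -/

section Geometry

variable {K : Type} [Field K] [NumberField K] [IsCMField K] {I : Type} [Fintype I] [Nonempty I]
  {Φ : I → CMType K} {A : I → AbelianVariety ℂ} {ι : ∀ i, 𝓞 K →+* End (A i)}
  {θ : ∀ i, K →+* Module.End ℂ (complexBetti (A i).X 1)}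

/-- **Pair-flip field, pairwise non-isogenous `A_i` with CM by `K`: every Hodge class on every product
`⨁_{j<N} A_{π j}` is a polynomial in divisor classes (`Bᵐ ⊗ ℂ = Dᵐ ⊗ ℂ`) iff the type vectors `u_{Φ_i}` are linearly
independent** (Murty–Hazama (1) ⟺ (3), with the rank condition read off the type vectors). -/
theorem forall_prod_hodgeClassSpan_eq_iff_linearIndependent
    (hflip : ∀ s : K →+* ℂ, ∃ σ : ℂ ≃+* ℂ, σ • s = (starRingAut : ℂ ≃+* ℂ) • s ∧
      ∀ t : K →+* ℂ, t ≠ s → t ≠ (starRingAut : ℂ ≃+* ℂ) • s → σ • t = t)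
    (hA : ∀ i, IsCMTypeRealisation (Φ i) (A i) (ι i) (θ i))
    (hniso : ∀ i j, i ≠ j → ¬AbelianVariety.IsIsogenous (A i) (A j)) :
    (∀ (N : ℕ) (π : Fin N → I) (m : ℕ),
      hodgeClassSpan (⨁ fun j : Fin N => A (π j)).dim (⨁ fun j : Fin N => A (π j)).X m =
        divisorClassesSpan (⨁ fun j : Fin N => A (π j)).X (⨁ fun j : Fin N => A (π j)).dim m) ↔
      LinearIndependent ℚ fun i => antiVec (Φ i).1 (1 : ℂ ≃+* ℂ) := by
  classical
  rw [← isNondegenerateFamily_iff_linearIndependent_of_pairFlip hflip Φ]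
  exact (CMAlgebra.isNondegenerateFamily_iff_forall_prod_hodgeClassSpan_eq (K := fun _ : I => K)
    (CMAlgebra.isSeparatingFamily_of_isSimple_of_pairwise_not_isIsogenous hA
      (fun i => isSimple_of_pairFlip hflip (hA i)) hniso) hA).symm

/-- **… and some product carries an exceptional Hodge class (a rational `(m,m)`-class outside `Dᵐ ⊗ ℂ`) iff the type
vectors are linearly DEPENDENT.** -/
theorem exists_exceptional_prod_iff_not_linearIndependent
    (hflip : ∀ s : K →+* ℂ, ∃ σ : ℂ ≃+* ℂ, σ • s = (starRingAut : ℂ ≃+* ℂ) • s ∧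
      ∀ t : K →+* ℂ, t ≠ s → t ≠ (starRingAut : ℂ ≃+* ℂ) • s → σ • t = t)
    (hA : ∀ i, IsCMTypeRealisation (Φ i) (A i) (ι i) (θ i))
    (hniso : ∀ i j, i ≠ j → ¬AbelianVariety.IsIsogenous (A i) (A j)) :
    (∃ (N : ℕ) (π : Fin N → I) (m : ℕ) (c : complexBetti (⨁ fun j : Fin N => A (π j)).X (2 * m)),
      IsRationalClass c ∧
      IsOfHodgeType (⨁ fun j : Fin N => A (π j)).dim (⨁ fun j : Fin N => A (π j)).X (2 * m) m m c ∧
      c ∉ divisorClassesSpan (⨁ fun j : Fin N => A (π j)).X (⨁ fun j : Fin N => A (π j)).dim m) ↔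
      ¬ LinearIndependent ℚ fun i => antiVec (Φ i).1 (1 : ℂ ≃+* ℂ) := by
  classical
  rw [← isNondegenerateFamily_iff_linearIndependent_of_pairFlip hflip Φ]
  have hsep := CMAlgebra.isSeparatingFamily_of_isSimple_of_pairwise_not_isIsogenous hA
    (fun i => isSimple_of_pairFlip hflip (hA i)) hniso
  refine ⟨?_, fun hΦ => CMAlgebra.exists_exceptional_prod_of_not_isNondegenerateFamily (K := fun _ : I => K) hsep hΦ hA⟩
  rintro ⟨N, π, m, c, hcQ, hcH, hcD⟩ hΦ
  exact hcD ((hΦ.hodgeClassSpan_prod_eq_divisorClassesSpan (K := fun _ : I => K) hA π m) ▸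
    Submodule.subset_span ⟨hcQ, hcH⟩)

end Geometry

end Summit.HodgeConjecture.CorCM.GenericCMField
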